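import Summits.QuantumFields.BalabanUV.Beta.RelInvNullShift

/-!
# `BalabanUV.Beta.RelInvBlindTransport` — binder row D1, RULING R-D1-g35-1 (chart (III′)), brick P2's ASSEMBLY at the abstract level:
# **A RELATIVE INVERSE IS TRANSPORTED BETWEEN TWO SLICES BY DRESSINGS THE SPREAD DOES NOT SEE** —
# `RelInv G M E_s` + (`M` blind to `P`, `Pᵗ`, `S`, `Sᵗ`) + (`E_s ∘ (S ∘ E_c) = S ∘ E_c`, `(E_c ∘ Sᵗ) ∘ E_s = E_c ∘ Sᵗ`) + (`(P ∘ S) ∘ E_c = E_c`, `E_c ∘ (Sᵗ ∘ Pᵗ) = E_c`)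
# + rules 1–2 for `G′ := P ∘ G ∘ Pᵗ` on `E_c` ⟹ `RelInv G′ M E_c` (an3 g78's two `calc` chains for rules 3–4, W-an3-g78-1 ∕ memo QAN2G351-AN3 §3, in tame associativity)

HONEST FRAMING (cell contract, verbatim): «discharging `BetaPertH` makes Bałaban's UV stability UNCONDITIONAL — a real constructive-QFT
result; it is NOT the continuum limit and NOT the Clay problem.»  HONEST DEPENDENCY: continuum YM on T⁴ ⇐ BetaPertH ∧ nine spine estimates (0/9 proved);
BetaPertH ⇐ (D1) ∧ (D4) ∧ CAP+tail; G-an2-4 gates asym, D1 and NE2/3/4.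
DERIVED cell leaf (β sub-cell, BINDER-OWNERS row D1 OWNER `b2b-balaban-beta-an2` gen 35; the OWNER's assembly brick of P2 in RULING R-D1-g35-1, memo
`HOME/b2b-balaban-beta-an2/gen35/R-D1-g35-1-CHART-IIIprime.v1.md`; the algebra is an3's XAN262-AN3 §3 ∕ QAN2G351-AN3 §3).  WHY.  In chart (III′) the
relative inverse `RelInv (coDressKAt ρ_c Lc (Gsym Lc j)) (bhKStepSh d Lc (Dsh Lc) j) (axEc ρ_c Lc)` (P2) is assembled from SIX kinds of letters: K0 = chart (II)'s
`RelInvNullShift.relInv_Gsym_bhKStep_add` (`RelInv G M E_s`), K1 = B1 (the legged spread is blind to the ROOTED comb dressing `piK ρ_c` on both sides — leaf-03 g19,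
`CombChartSpreadBlind`), K2–K4 = B2 (the ROOTED symmetrised dressing `piKSym`: blindness of the spread, range in the sym slice, absorption by the comb dressing —
OFFERED), K5 + rules 1–2 = B3 (`CombChartResolventRules` §3–§4).  THIS FILE is the LETTER-FREE algebra that turns those identities into the four relative rules, over
ABSTRACT spread kernels `G M E_s E_c P Pt S St` of any leg type — so that the kernel-level P2 is ONE `exact` once K1–K5 are in the tree, whatever C-restricted letter
shapes their authors choose (substitution lemmas reconcile them at instantiation).  No statement of Bałaban's papers, no `[cite:]`, no `Prop` fact, no `def`.
Discharges NO binder of the row; RECORD = ROOT M′ p303989 (chart (II)) unchanged; NOT D1, NOT `BetaPertH`, NOT continuum, NOT Clay.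
CONTENT ([folklore], tame associativity only): §1 `rule3_transport`, `rule4_transport` with exactly the hypotheses each chain uses; §2 `relInv_transport_of_blind`
(composite absorption; an3 g79's O-an3-g79-1 (R2) instantiability repair folded in) and `relInv_transport_of_blind_split` (split absorption).
Provenance: β sub-cell, unit beta-an2 gen 35, 2026-08-21 (v1); over `ChartConjugationRelative` (`RelInv`, `spr_comp`), `TameKernelCalculus` (`comp_assoc_tame`) BY NAME
(imported through `RelInvNullShift`); no existing file touched.
-/

noncomputable section

open Literature.MathematicalPhysics.QuantumFieldTheory
open Literature.MathematicalPhysics.QuantumFieldTheory.Balaban1983to89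
open Literature.MathematicalPhysics.QuantumFieldTheory.Balaban1983to89.Beta
open ExpKernelCalculus (MKer comp)
open Summit.QuantumFields.BalabanUV.Beta.TameKernelCalculus
open Summit.QuantumFields.BalabanUV.Beta.ChartConjugationRelative (RelInv spr_comp)

namespace Summit.QuantumFields.BalabanUV.Beta.RelInvBlindTransport

variable {D : ℕ} {F : Type*} [Fintype F]
variable {G M Es Ec P Pt S St : MKer D F}

/-! ## §1 The two chains -/

/-- [folklore] **RULE 3 TRANSPORTED**: `((P∘G∘Pᵗ)∘M)∘E_c = E_c` from rule 3 of `(G, M, E_s)`, left blindness `Pᵗ∘M = M`, right blindness `M∘S = M`, the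
range condition in its WEAK form `E_s∘(S∘E_c) = S∘E_c` (implied by `E_s∘S = S`; the weak form is what survives when the auxiliary dressing carries the identity on
idle multiplier legs that `E_s` kills), and the COMPOSITE absorption `(P∘S)∘E_c = E_c` (implied by `P∘S = P` + `P∘E_c = E_c`, or by an3's C-restricted pair
`P∘S = P_C`, `P_C∘E_c = E_c` — O-an3-g79-1's repair (R2)) (all kernels spread).  Chain (an3): `G′ME_c = PGPᵗME_c = PGME_c = PGM(SE_c) = PGME_s(SE_c) =
(PGME_s)(SE_c) = PE_s(SE_c) = P(SE_c) = (PS)E_c = E_c`. -/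
theorem rule3_transport (hG : Spr G) (hM : Spr M) (hEs : Spr Es) (hEc : Spr Ec) (hP : Spr P) (hPt : Spr Pt) (hS : Spr S)
    (h3 : comp (comp G M) Es = Es) (hPtM : comp Pt M = M) (hMS : comp M S = M) (hEsS : comp Es (comp S Ec) = comp S Ec)
    (hPSEc : comp (comp P S) Ec = Ec) :
    comp (comp (comp (comp P G) Pt) M) Ec = Ec := by
  have tPG : Tame (comp P G) := (spr_comp hP hG).tame
  have tSE : Tame (comp S Ec) := (spr_comp hS hEc).tame
  have e1 : comp (comp (comp P G) Pt) M = comp (comp P G) M := by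
    rw [← comp_assoc_tame tPG hPt.tame hM.tame, hPtM]
  have e2 : comp (comp (comp P G) M) Es = comp P Es := by
    rw [← comp_assoc_tame tPG hM.tame hEs.tame, ← comp_assoc_tame hP.tame hG.tame (spr_comp hM hEs).tame,
      comp_assoc_tame hG.tame hM.tame hEs.tame, h3]
  calc comp (comp (comp (comp P G) Pt) M) Ec
      = comp (comp (comp P G) M) Ec := by rw [e1]
    _ = comp (comp (comp P G) (comp M S)) Ec := by rw [hMS]
    _ = comp (comp (comp (comp P G) M) S) Ec := by rw [comp_assoc_tame tPG hM.tame hS.tame]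
    _ = comp (comp (comp P G) M) (comp S Ec) := (comp_assoc_tame (spr_comp (spr_comp hP hG) hM).tame hS.tame hEc.tame).symm
    _ = comp (comp (comp P G) M) (comp Es (comp S Ec)) := by rw [hEsS]
    _ = comp (comp (comp (comp P G) M) Es) (comp S Ec) := comp_assoc_tame (spr_comp (spr_comp hP hG) hM).tame hEs.tame tSE
    _ = comp (comp P Es) (comp S Ec) := by rw [e2]
    _ = comp P (comp Es (comp S Ec)) := (comp_assoc_tame hP.tame hEs.tame tSE).symm
    _ = comp P (comp S Ec) := by rw [hEsS]
    _ = comp (comp P S) Ec := comp_assoc_tame hP.tame hS.tame hEc.tame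
    _ = Ec := hPSEc

/-- [folklore] **RULE 4 TRANSPORTED**: `(E_c∘M)∘(P∘G∘Pᵗ) = E_c` from rule 4 of `(G, M, E_s)`, right blindness `M∘P = M`, left blindness `Sᵗ∘M = M`, the
range condition in its WEAK form `(E_c∘Sᵗ)∘E_s = E_c∘Sᵗ` (implied by `Sᵗ∘E_s = Sᵗ`), and the COMPOSITE absorption `E_c∘(Sᵗ∘Pᵗ) = E_c` (implied by `Sᵗ∘Pᵗ = Pᵗ` +
`E_c∘Pᵗ = E_c`, or by the C-restricted pair).  Chain: `E_cMG′ = E_cMPGPᵗ = E_cMGPᵗ = (E_cSᵗ)MGPᵗ = (E_cSᵗ)E_sMGPᵗ = (E_cSᵗ)(E_sMG)Pᵗ = (E_cSᵗ)E_sPᵗ = E_cSᵗPᵗ =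
E_c(SᵗPᵗ) = E_c`. -/
theorem rule4_transport (hG : Spr G) (hM : Spr M) (hEs : Spr Es) (hEc : Spr Ec) (hP : Spr P) (hPt : Spr Pt) (hSt : Spr St)
    (h4 : comp (comp Es M) G = Es) (hMP : comp M P = M) (hStM : comp St M = M) (hStEs : comp (comp Ec St) Es = comp Ec St)
    (hEcStPt : comp Ec (comp St Pt) = Ec) :
    comp (comp Ec M) (comp (comp P G) Pt) = Ec := by
  have tEM : Tame (comp Ec M) := (spr_comp hEc hM).tame
  have tES : Tame (comp Ec St) := (spr_comp hEc hSt).tame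
  have e1 : comp (comp Ec M) (comp P G) = comp (comp Ec M) G := by
    rw [comp_assoc_tame tEM hP.tame hG.tame, ← comp_assoc_tame hEc.tame hM.tame hP.tame, hMP]
  have e2 : comp Ec M = comp (comp Ec St) (comp Es M) := by
    calc comp Ec M = comp Ec (comp St M) := by rw [hStM]
      _ = comp (comp Ec St) M := comp_assoc_tame hEc.tame hSt.tame hM.tame
      _ = comp (comp (comp Ec St) Es) M := by rw [hStEs]
      _ = comp (comp Ec St) (comp Es M) := (comp_assoc_tame tES hEs.tame hM.tame).symm
  have e3 : comp (comp Ec M) G = comp Ec St := by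
    rw [e2, ← comp_assoc_tame tES (spr_comp hEs hM).tame hG.tame, h4, hStEs]
  calc comp (comp Ec M) (comp (comp P G) Pt)
      = comp (comp (comp Ec M) (comp P G)) Pt := comp_assoc_tame tEM (spr_comp hP hG).tame hPt.tame
    _ = comp (comp (comp Ec M) G) Pt := by rw [e1]
    _ = comp (comp Ec St) Pt := by rw [e3]
    _ = comp Ec (comp St Pt) := by rw [← comp_assoc_tame hEc.tame hSt.tame hPt.tame]
    _ = Ec := hEcStPt

/-! ## §2 The transported relative inverse -/

/-- [folklore] **TRANSPORT OF A RELATIVE INVERSE ALONG BLIND DRESSINGS** (composite form).  Let `RelInv G M E_s` (the source chart), let the spread `M` be blind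
to the target dressing (`Pᵗ∘M = M = M∘P`) and to an auxiliary dressing (`Sᵗ∘M = M = M∘S`) whose range lies in the source slice in the weak sense
(`E_s∘(S∘E_c) = S∘E_c`, `(E_c∘Sᵗ)∘E_s = E_c∘Sᵗ`) and which the target dressing absorbs INTO the target slice (`(P∘S)∘E_c = E_c`, `E_c∘(Sᵗ∘Pᵗ) = E_c`), and let
`G′ := P∘G∘Pᵗ` satisfy rules 1–2 on `E_c`.  Then `RelInv G′ M E_c`.  (Instance aimed at: `G := Gsym Lc j`, `M := bhKStepSh d Lc (Dsh Lc) j`, `E_s := symEc Lc`,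
`E_c := axEc ρ_c Lc`, `P := trK (piK ρ_c Lc)`, `Pt := piK ρ_c Lc`, `S ∕ St` := the ROOTED symmetrised dressing pair (`trK piKSym(C)` ∕ `piKSym(C)`) — P2 of RULING
R-D1-g35-1; nothing in the lemma looks inside `G`; the composite hypotheses are what both instantiation routes supply — unrestricted `S` with `P∘S = P`,
`P∘E_c = E_c`, or an3's C-restricted `S` with `P∘S = P_C`, `P_C∘E_c = E_c` (O-an3-g79-1 (R2)).) -/
theorem relInv_transport_of_blind (hG : Spr G) (hM : Spr M) (hEs : Spr Es) (hEc : Spr Ec) (hP : Spr P) (hPt : Spr Pt) (hS : Spr S) (hSt : Spr St)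
    (hR : RelInv G M Es)
    (hPtM : comp Pt M = M) (hMP : comp M P = M)
    (hMS : comp M S = M) (hStM : comp St M = M) (hEsS : comp Es (comp S Ec) = comp S Ec) (hStEs : comp (comp Ec St) Es = comp Ec St)
    (hPSEc : comp (comp P S) Ec = Ec) (hEcStPt : comp Ec (comp St Pt) = Ec)
    (h1 : comp Ec (comp (comp P G) Pt) = comp (comp P G) Pt) (h2 : comp (comp (comp P G) Pt) Ec = comp (comp P G) Pt) :
    RelInv (comp (comp P G) Pt) M Ec :=
  ⟨h1, h2, rule3_transport hG hM hEs hEc hP hPt hS hR.AME hPtM hMS hEsS hPSEc,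
    rule4_transport hG hM hEs hEc hP hPt hSt hR.EMA hMP hStM hStEs hEcStPt⟩

/-- [folklore] The same with SPLIT absorption hypotheses (`P∘S = P`, `Sᵗ∘Pᵗ = Pᵗ`: the target dressing absorbs the auxiliary one — same gauge-parameter class —
and `P∘E_c = E_c = E_c∘Pᵗ`: it fixes the target slice) and the STRONG range conditions `E_s∘S = S`, `Sᵗ∘E_s = Sᵗ` weakened internally; for instantiations where
the auxiliary dressing kernel is typed with the full multiplier identity and the range conditions are supplied in the weak form, use the theorem above. -/
theorem relInv_transport_of_blind_split (hG : Spr G) (hM : Spr M) (hEs : Spr Es) (hEc : Spr Ec) (hP : Spr P) (hPt : Spr Pt) (hS : Spr S) (hSt : Spr St)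
    (hR : RelInv G M Es)
    (hPtM : comp Pt M = M) (hMP : comp M P = M)
    (hMS : comp M S = M) (hStM : comp St M = M) (hEsS : comp Es (comp S Ec) = comp S Ec) (hStEs : comp (comp Ec St) Es = comp Ec St)
    (hPS : comp P S = P) (hStPt : comp St Pt = Pt) (hPEc : comp P Ec = Ec) (hEcPt : comp Ec Pt = Ec)
    (h1 : comp Ec (comp (comp P G) Pt) = comp (comp P G) Pt) (h2 : comp (comp (comp P G) Pt) Ec = comp (comp P G) Pt) :
    RelInv (comp (comp P G) Pt) M Ec :=
  relInv_transport_of_blind hG hM hEs hEc hP hPt hS hSt hR hPtM hMP hMS hStM hEsS hStEs (by rw [hPS, hPEc]) (by rw [hStPt, hEcPt]) h1 h2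

end Summit.QuantumFields.BalabanUV.Beta.RelInvBlindTransport

end
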